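import Summits.NavierStokesRegularity.NavierStokesRegularity.Theses.PalasekTowerBreakdown
import Summits.NavierStokesRegularity.FluidComputer.PalasekTowerHeredityOrBreakdownCeiling
import Summits.NavierStokesRegularity.FluidComputer.PalasekTowerRegisterGlobalFloorsAt

/-!
# NavierStokesRegularity — route `PalasekTowerBreakdown`, item `HeredityFromTwo`: the item minus «no premature
# blow-up» still closes the route; the registered upper stub `AprioriCeiling` splits, by name

Supports `stmt-NavierStokesRegularity-19250` (`PalasekTowerBreakdown.HeredityFromTwo := HeredityFrom 2`; it does
NOT close it). Cell `ns-blowup`, seat `ns-palasek-19250-p2` (g2, STUB-WORKER on the upper stub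
`stub_apriori_ceiling : AprioriCeiling` of skeleton v3 c7f4b5fa45c722f3; lead of record ns-palasek-19250-p1).
LABEL: E–C typing + kernel glue over this seat's `FluidComputer/PalasekTowerHeredityOrBreakdown.lean` (p473253)
and `…HeredityOrBreakdownCeiling.lean`. WHAT THIS IS NOT: not NS — no stage, flow or tower is constructed; the
item is OPEN and appears only inside equivalences / implications; no stub is decided.

THE OBSERVATION. `AprioriCeiling` quantifies over every PARTIAL continuation `[0, T'] ⊆ [0, τ (k+1)]` of every
registered level-`k` stage (`k ≥ 2`), so a registered design whose free flow overshoots `c₂ Y_{k+1}` at some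
`T' < τ (k+1)` and then loses smoothness before `τ (k+1)` refutes the item — yet that design IS a witness of
Fefferman's (C) (`Stage.navierStokesBreakdownR3_of_not_livesTo`: Clay datum + Clay-class force of the schedule,
no global smooth bounded-energy solution by restriction, every viscosity by dilation). By name on the route:

* `palasekTowerBreakdown_heredityFromTwo_orBreakdown` — the item implies its weak form
  `HeredityOrBreakdownFrom 2` («every registered level-`k` stage, `k ≥ 2`, extends to level `k + 1` OR its
  design's flow does not live to `τ (k+1)`»);
* `palasekTowerBreakdown_breakdownR3_of_base_heredityAtOne_orBreakdownFrom_two` /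
  `…_of_base_orBreakdownAt_one_orBreakdownFrom_two` — the route's deciding theorem `closes` with binder 3
  (resp. binders 2 and 3) WEAKENED to the or-breakdown forms, same conclusion `NavierStokesBreakdownR3`;
* `palasekTowerBreakdown_heredityFromTwo_or_breakdownR3_of_orBreakdown` — conversely the weak form gives back
  the item OR proves (C) outright; so `¬(C) → (item ↔ weak form)` and any refutation of the item either refutes
  the weak form or proves (C) (`…_not_heredityFromTwo_dichotomy`);
* `palasekTowerBreakdown_heredityFromTwo_iff_noPrematureBreakdown_windowCeiling_floors3` — the item is
  «no premature breakdown» × window ceiling × the three `k`-uniform floors; its weak form is the last four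
  conjuncts (`…_orBreakdownFrom_two_iff_windowCeiling_floors3`): a re-cut of skeleton v3 under the weak form
  would keep `stub_speed_floors` / `stub_strain_floors` / `stub_core_floors` VERBATIM and replace
  `stub_apriori_ceiling : AprioriCeiling` by `∀ k ≥ 2, WindowCeilingAt k` (the lead's / planner's call, D-0014);
* `palasekTowerBreakdown_stub_apriori_ceiling_iff` — the registered upper stub itself:
  `AprioriCeiling ↔ (∀ k ≥ 2, NoPrematureBreakdownAt k) ∧ (∀ k ≥ 2, WindowCeilingAt k)`, with
  `¬ NoPrematureBreakdownAt k → NavierStokesBreakdownR3`.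

Honest status: the weakening removes one refutation mode (overshoot-then-blow-up) and one proof obligation (no
premature blow-up); it does NOT make the window ceiling or the floors easier — both halves remain bets on the
registered class (verdict of record, START-HERE-D0081 §C.2 RE-PRICE 20:35Z).

References: S. Palasek, arXiv:2605.13827 §4 [cite: Palasek2026ElementaryModel, §4]; C. L. Fefferman, Clay
problem description, (C) [cite: FeffermanClay2006, (C)]; H. Sohr, *The Navier–Stokes Equations*, Birkhäuser
2001, Ch. V Thm. 1.5.1 [cite: Sohr2001, Ch. V Thm. 1.5.1].
-/

-- `Summit.<Summit>.<Problem>` is the tree's mandated summit-side namespace (CONVENTIONS §2); for this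
-- single-conjunct summit the two coincide, so the duplicate is deliberate.
set_option linter.dupNamespace false

namespace Summit.NavierStokesRegularity.NavierStokesRegularity.Theorems

open Set MeasureTheory
open scoped ENNReal ContDiff
open Literature.Analysis.FluidPDE
open Summit.NavierStokesRegularity.NavierStokesRegularity.Theses
open Summit.NavierStokesRegularity.FluidComputer.PalasekTowerClayBridge

/-! ## §1 The item implies its weak form; the weak form still closes the route -/

/-- **`HeredityFromTwo → HeredityOrBreakdownFrom 2`** (free direction). [folklore] -/
theorem palasekTowerBreakdown_heredityFromTwo_orBreakdown (h : PalasekTowerBreakdown.HeredityFromTwo) :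
    HeredityOrBreakdownFrom 2 := by
  unfold PalasekTowerBreakdown.HeredityFromTwo at h
  exact h.orBreakdown

/-- **`HeredityAtOne → HeredityOrBreakdownAt 1`** (free direction, sibling item 19249). [folklore] -/
theorem palasekTowerBreakdown_heredityAtOne_orBreakdown (h : PalasekTowerBreakdown.HeredityAtOne) :
    HeredityOrBreakdownAt 1 := by
  unfold PalasekTowerBreakdown.HeredityAtOne at h
  exact HeredityAt.orBreakdown (heredityAtOne_iff.1 h)

/-- **The route's deciding theorem with binder 3 WEAKENED**:
`EpisodeBase → HeredityAtOne → HeredityOrBreakdownFrom 2 → NavierStokesBreakdownR3` (compare `closes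
(h₁ : EpisodeBase) (h₂ : HeredityAtOne) (h₃ : HeredityFromTwo)`). The base design's chain either reaches every
level (`navierStokesBreakdownR3_of_nonempty_stages`, PATH B′, no named fact) or dies at a finite level, which IS
(C). [cite: FeffermanClay2006, (C)] -/
theorem palasekTowerBreakdown_breakdownR3_of_base_heredityAtOne_orBreakdownFrom_two
    (h₁ : PalasekTowerBreakdown.EpisodeBase) (h₂ : PalasekTowerBreakdown.HeredityAtOne)
    (h₃ : HeredityOrBreakdownFrom 2) :
    Summit.NavierStokesRegularity.NavierStokesRegularity.NavierStokesBreakdownR3 := by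
  unfold PalasekTowerBreakdown.EpisodeBase at h₁
  exact navierStokesBreakdownR3_of_base_orBreakdownAt_one_orBreakdownFrom_two h₁
    (palasekTowerBreakdown_heredityAtOne_orBreakdown h₂) h₃

/-- **The route's deciding theorem with binders 2 AND 3 WEAKENED**:
`EpisodeBase → HeredityOrBreakdownAt 1 → HeredityOrBreakdownFrom 2 → NavierStokesBreakdownR3`.
[cite: FeffermanClay2006, (C)] -/
theorem palasekTowerBreakdown_breakdownR3_of_base_orBreakdownAt_one_orBreakdownFrom_two
    (h₁ : PalasekTowerBreakdown.EpisodeBase) (h₂ : HeredityOrBreakdownAt 1) (h₃ : HeredityOrBreakdownFrom 2) :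
    Summit.NavierStokesRegularity.NavierStokesRegularity.NavierStokesBreakdownR3 := by
  unfold PalasekTowerBreakdown.EpisodeBase at h₁
  exact navierStokesBreakdownR3_of_base_orBreakdownAt_one_orBreakdownFrom_two h₁ h₂ h₃

/-- Sanity: the route's own `closes` factors through the weak closer (nothing was lost). [folklore] -/
theorem palasekTowerBreakdown_closes_via_orBreakdown (h₁ : PalasekTowerBreakdown.EpisodeBase)
    (h₂ : PalasekTowerBreakdown.HeredityAtOne) (h₃ : PalasekTowerBreakdown.HeredityFromTwo) :
    Summit.NavierStokesRegularity.NavierStokesRegularity.NavierStokesBreakdownR3 :=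
  palasekTowerBreakdown_breakdownR3_of_base_heredityAtOne_orBreakdownFrom_two h₁ h₂
    (palasekTowerBreakdown_heredityFromTwo_orBreakdown h₃)

/-! ## §2 The weak form gives back the item — or (C) -/

/-- **`HeredityOrBreakdownFrom 2 → HeredityFromTwo ∨ NavierStokesBreakdownR3`**: if no registered design dies
inside a window at any level `k ≥ 2` the weak form IS the item; if one does, that design is (C).
[cite: FeffermanClay2006, (C)] -/
theorem palasekTowerBreakdown_heredityFromTwo_or_breakdownR3_of_orBreakdown (h : HeredityOrBreakdownFrom 2) :
    PalasekTowerBreakdown.HeredityFromTwo ∨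
      Summit.NavierStokesRegularity.NavierStokesRegularity.NavierStokesBreakdownR3 := by
  unfold PalasekTowerBreakdown.HeredityFromTwo
  by_cases hN : ∀ k, 2 ≤ k → NoPrematureBreakdownAt k
  · exact Or.inl ((heredityFrom_iff_orBreakdown_and_noPrematureBreakdown 2).2 ⟨h, hN⟩)
  · simp only [not_forall] at hN
    obtain ⟨k, _, hk⟩ := hN
    exact Or.inr (navierStokesBreakdownR3_of_not_noPrematureBreakdownAt hk)

/-- **In a world without breakdown the item and its weak form coincide.** [folklore] -/
theorem palasekTowerBreakdown_heredityFromTwo_iff_orBreakdown_of_not_breakdownR3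
    (hC : ¬ Summit.NavierStokesRegularity.NavierStokesRegularity.NavierStokesBreakdownR3) :
    PalasekTowerBreakdown.HeredityFromTwo ↔ HeredityOrBreakdownFrom 2 :=
  ⟨palasekTowerBreakdown_heredityFromTwo_orBreakdown,
    fun h => (palasekTowerBreakdown_heredityFromTwo_or_breakdownR3_of_orBreakdown h).resolve_right hC⟩

/-- **Any refutation of the item either refutes its weak form or proves (C)** — an overshoot-then-blow-up
design (the refutation mode the weak form discards) is a Clay (C) witness. [folklore] -/
theorem palasekTowerBreakdown_not_heredityFromTwo_dichotomy (h : ¬ PalasekTowerBreakdown.HeredityFromTwo) :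
    ¬ HeredityOrBreakdownFrom 2 ∨
      Summit.NavierStokesRegularity.NavierStokesRegularity.NavierStokesBreakdownR3 := by
  by_cases hO : HeredityOrBreakdownFrom 2
  · exact Or.inr ((palasekTowerBreakdown_heredityFromTwo_or_breakdownR3_of_orBreakdown hO).resolve_left h)
  · exact Or.inl hO

/-- **The item is its weak form plus «no premature breakdown» at every `k ≥ 2`.** [folklore] -/
theorem palasekTowerBreakdown_heredityFromTwo_iff_orBreakdown_and_noPrematureBreakdown :
    PalasekTowerBreakdown.HeredityFromTwo ↔
      HeredityOrBreakdownFrom 2 ∧ ∀ k, 2 ≤ k → NoPrematureBreakdownAt k := by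
  unfold PalasekTowerBreakdown.HeredityFromTwo
  exact heredityFrom_iff_orBreakdown_and_noPrematureBreakdown 2

/-- … and the extra clause is «(C) if false»: `¬ NoPrematureBreakdownAt k → NavierStokesBreakdownR3`.
[cite: FeffermanClay2006, (C)] -/
theorem palasekTowerBreakdown_breakdownR3_of_prematureBreakdown {k : ℕ} (h : ¬ NoPrematureBreakdownAt k) :
    Summit.NavierStokesRegularity.NavierStokesRegularity.NavierStokesBreakdownR3 :=
  navierStokesBreakdownR3_of_not_noPrematureBreakdownAt h

/-! ## §3 The registered stubs of skeleton v3 under the split -/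

/-- **The registered UPPER stub splits**: `AprioriCeiling ↔ (∀ k ≥ 2, NoPrematureBreakdownAt k) ∧
(∀ k ≥ 2, WindowCeilingAt k)` — clause × window ceiling of the survivors (`stub_apriori_ceiling : AprioriCeiling`
of `Cruxes/HeredityFromTwo/Lines/birth.lean` v3). [cite: Sohr2001, Ch. V Thm. 1.5.1] -/
theorem palasekTowerBreakdown_stub_apriori_ceiling_iff :
    AprioriCeiling ↔ (∀ k, 2 ≤ k → NoPrematureBreakdownAt k) ∧ (∀ k, 2 ≤ k → WindowCeilingAt k) :=
  aprioriCeiling_iff_noPrematureBreakdown_and_windowCeiling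

/-- **The item as FIVE conjuncts matching skeleton v3**: `HeredityFromTwo ↔ (∀ k ≥ 2, NoPrematureBreakdownAt k)
∧ (∀ k ≥ 2, WindowCeilingAt k) ∧ (∀ k ≥ 2, SpeedFloorAt k) ∧ (∀ k ≥ 2, StrainFloorAt k) ∧ (∀ k ≥ 2, CoreFloorAt k)`
— no hypothesis (`readoutFloors_iff_forall_floors` for the lower three). [folklore] -/
theorem palasekTowerBreakdown_heredityFromTwo_iff_noPrematureBreakdown_windowCeiling_floors3 :
    PalasekTowerBreakdown.HeredityFromTwo ↔
      (∀ k, 2 ≤ k → NoPrematureBreakdownAt k) ∧ (∀ k, 2 ≤ k → WindowCeilingAt k) ∧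
        (∀ k, 2 ≤ k → SpeedFloorAt k) ∧ (∀ k, 2 ≤ k → StrainFloorAt k) ∧ (∀ k, 2 ≤ k → CoreFloorAt k) := by
  unfold PalasekTowerBreakdown.HeredityFromTwo
  rw [heredityFrom_two_iff_noPrematureBreakdown_windowCeiling_floors, readoutFloors_iff_forall_floors]
  constructor
  · rintro ⟨hN, hW, hF⟩
    exact ⟨hN, hW, fun k hk => (hF k hk).1, fun k hk => (hF k hk).2.1, fun k hk => (hF k hk).2.2⟩
  · rintro ⟨hN, hW, h₁, h₂, h₃⟩
    exact ⟨hN, hW, fun k hk => ⟨h₁ k hk, h₂ k hk, h₃ k hk⟩⟩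

/-- **The weak form as FOUR conjuncts — the three floor stubs of skeleton v3 VERBATIM plus the window ceiling**:
`HeredityOrBreakdownFrom 2 ↔ (∀ k ≥ 2, WindowCeilingAt k) ∧ (∀ k ≥ 2, SpeedFloorAt k) ∧ (∀ k ≥ 2, StrainFloorAt k)
∧ (∀ k ≥ 2, CoreFloorAt k)`. [folklore] -/
theorem palasekTowerBreakdown_orBreakdownFrom_two_iff_windowCeiling_floors3 :
    HeredityOrBreakdownFrom 2 ↔
      (∀ k, 2 ≤ k → WindowCeilingAt k) ∧
        (∀ k, 2 ≤ k → SpeedFloorAt k) ∧ (∀ k, 2 ≤ k → StrainFloorAt k) ∧ (∀ k, 2 ≤ k → CoreFloorAt k) := by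
  rw [heredityOrBreakdownFrom_two_iff_windowCeiling_and_readoutFloors, readoutFloors_iff_forall_floors]
  constructor
  · rintro ⟨hW, hF⟩
    exact ⟨hW, fun k hk => (hF k hk).1, fun k hk => (hF k hk).2.1, fun k hk => (hF k hk).2.2⟩
  · rintro ⟨hW, h₁, h₂, h₃⟩
    exact ⟨hW, fun k hk => ⟨h₁ k hk, h₂ k hk, h₃ k hk⟩⟩

/-- **Composition for a re-cut under the weak form** (four by-name hypotheses, skeleton-audit shape):
window ceiling + the three registered floor stubs ⇒ `HeredityOrBreakdownFrom 2`; with `EpisodeBase` and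
`HeredityAtOne` (or `HeredityOrBreakdownAt 1`) this closes the route's target by
`palasekTowerBreakdown_breakdownR3_of_base_heredityAtOne_orBreakdownFrom_two`. [folklore] -/
theorem palasekTowerBreakdown_orBreakdownFrom_two_of_windowCeiling_floors3
    (hW : ∀ k, 2 ≤ k → WindowCeilingAt k) (h₁ : ∀ k, 2 ≤ k → SpeedFloorAt k)
    (h₂ : ∀ k, 2 ≤ k → StrainFloorAt k) (h₃ : ∀ k, 2 ≤ k → CoreFloorAt k) : HeredityOrBreakdownFrom 2 :=
  palasekTowerBreakdown_orBreakdownFrom_two_iff_windowCeiling_floors3.2 ⟨hW, h₁, h₂, h₃⟩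

/-- **The item from its five conjuncts** (composition shape: the four above plus the clause). [folklore] -/
theorem palasekTowerBreakdown_heredityFromTwo_of_noPrematureBreakdown_windowCeiling_floors3
    (hN : ∀ k, 2 ≤ k → NoPrematureBreakdownAt k) (hW : ∀ k, 2 ≤ k → WindowCeilingAt k)
    (h₁ : ∀ k, 2 ≤ k → SpeedFloorAt k) (h₂ : ∀ k, 2 ≤ k → StrainFloorAt k)
    (h₃ : ∀ k, 2 ≤ k → CoreFloorAt k) : PalasekTowerBreakdown.HeredityFromTwo :=
  palasekTowerBreakdown_heredityFromTwo_iff_noPrematureBreakdown_windowCeiling_floors3.2 ⟨hN, hW, h₁, h₂, h₃⟩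

end Summit.NavierStokesRegularity.NavierStokesRegularity.Theorems
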